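import Summits.Ventures.PercRepro.C041TriDomExcessTriangleStatus

/-!
# ROW C-041 — THE EQUALITY CASE OF THE EXCESS, V: A TRIANGLE ON THE MARKS FORCES `e ≥ 1` (p6, gen 43; §53 ADDENDUM 2)

On part IV (`C041TriDomExcessTriangleStatus`: the triangle status, its patterns `triPat` and the contribution `triG`).
(i) The eight fibres of `ω ↦ (ω f₁, ω f₂, ω f₃)` are equinumerous (the flips, `card_fiber_eq`) and sum to `2^#E₁`
(`eight_mul_card_fiber`), so `esym triSt ≥ 2 · #fibre` (`esym_triSt_ge`: the all-red and the all-blue fibres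
contribute `1` each, nothing contributes negatively).  (ii) Deleting the other edges one at a time multiplies the
normalised `esym` by at most `2` each (`esym_setAbsent_le`, from `esym_absent_le`), and there are `#E₁ − 3` of them
(`card_others`), so `esym (all free) ≥ 2` (`esym_free_ge_two_of_triangle`): **`excess_ge_one_of_triangle`** — if the
three distinct marks are pairwise joined by edges then `N_RRa ≥ N_RB + N_WRj + N_RWj + 1`.  With THEOREM (SEPARABLE
⟹ `e = 0`) this is the equality case for every host containing a triangle on its marks; the general converse
(cycle-or-tripod minors) stays paper.
-/

namespace PercRepro

namespace ZoneZ

namespace MultiExit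

open ZoneData Finset

variable {V₁ E₁ U₁ U₂ : Type} (Z₁ : ZoneData V₁ E₁ U₁ U₂) (u u' a₁ : V₁)

variable [DecidableEq E₁]

/-! ## The count -/

variable [Fintype E₁]

/-- The three colours of the triangle edges. -/
def bits (f₁ f₂ f₃ : E₁) (ω : E₁ → Bool) : Bool × Bool × Bool := (ω f₁, ω f₂, ω f₃)

open Classical in
/-- Flipping `f₁` maps the fibre of `(b₁, b₂, b₃)` onto the fibre of `(!b₁, b₂, b₃)` (as cards). -/
theorem card_fiber_flip₁ {f₁ f₂ f₃ : E₁} (h12 : f₁ ≠ f₂) (h13 : f₁ ≠ f₃) (b₁ b₂ b₃ : Bool) :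
    (univ.filter fun ω : E₁ → Bool => bits f₁ f₂ f₃ ω = (b₁, b₂, b₃)).card =
      (univ.filter fun ω : E₁ → Bool => bits f₁ f₂ f₃ ω = (!b₁, b₂, b₃)).card := by
  refine Finset.card_bij (fun ω _ => flipC f₁ ω) ?_ ?_ ?_
  · intro ω hω
    simp only [Finset.mem_filter, Finset.mem_univ, true_and, bits, Prod.mk.injEq] at hω ⊢
    obtain ⟨hb1, hb2, hb3⟩ := hω
    refine ⟨?_, ?_, ?_⟩
    · rw [flipC_apply_self, hb1]
    · unfold flipC; rw [Function.update_of_ne h12.symm]; exact hb2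
    · unfold flipC; rw [Function.update_of_ne h13.symm]; exact hb3
  · intro ω _ ω' _ h
    exact flipC_involutive f₁ |>.injective h
  · intro ω' hω'
    refine ⟨flipC f₁ ω', ?_, flipC_involutive f₁ ω'⟩
    simp only [Finset.mem_filter, Finset.mem_univ, true_and, bits, Prod.mk.injEq] at hω' ⊢
    obtain ⟨hb1, hb2, hb3⟩ := hω'
    refine ⟨?_, ?_, ?_⟩
    · rw [flipC_apply_self, hb1, Bool.not_not]
    · unfold flipC; rw [Function.update_of_ne h12.symm]; exact hb2
    · unfold flipC; rw [Function.update_of_ne h13.symm]; exact hb3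

open Classical in
/-- Flipping `f₂`. -/
theorem card_fiber_flip₂ {f₁ f₂ f₃ : E₁} (h12 : f₁ ≠ f₂) (h23 : f₂ ≠ f₃) (b₁ b₂ b₃ : Bool) :
    (univ.filter fun ω : E₁ → Bool => bits f₁ f₂ f₃ ω = (b₁, b₂, b₃)).card =
      (univ.filter fun ω : E₁ → Bool => bits f₁ f₂ f₃ ω = (b₁, !b₂, b₃)).card := by
  refine Finset.card_bij (fun ω _ => flipC f₂ ω) ?_ ?_ ?_
  · intro ω hω
    simp only [Finset.mem_filter, Finset.mem_univ, true_and, bits, Prod.mk.injEq] at hω ⊢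
    obtain ⟨hb1, hb2, hb3⟩ := hω
    refine ⟨?_, ?_, ?_⟩
    · unfold flipC; rw [Function.update_of_ne h12]; exact hb1
    · rw [flipC_apply_self, hb2]
    · unfold flipC; rw [Function.update_of_ne h23.symm]; exact hb3
  · intro ω _ ω' _ h
    exact flipC_involutive f₂ |>.injective h
  · intro ω' hω'
    refine ⟨flipC f₂ ω', ?_, flipC_involutive f₂ ω'⟩
    simp only [Finset.mem_filter, Finset.mem_univ, true_and, bits, Prod.mk.injEq] at hω' ⊢
    obtain ⟨hb1, hb2, hb3⟩ := hω'
    refine ⟨?_, ?_, ?_⟩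
    · unfold flipC; rw [Function.update_of_ne h12]; exact hb1
    · rw [flipC_apply_self, hb2, Bool.not_not]
    · unfold flipC; rw [Function.update_of_ne h23.symm]; exact hb3

open Classical in
/-- Flipping `f₃`. -/
theorem card_fiber_flip₃ {f₁ f₂ f₃ : E₁} (h13 : f₁ ≠ f₃) (h23 : f₂ ≠ f₃) (b₁ b₂ b₃ : Bool) :
    (univ.filter fun ω : E₁ → Bool => bits f₁ f₂ f₃ ω = (b₁, b₂, b₃)).card =
      (univ.filter fun ω : E₁ → Bool => bits f₁ f₂ f₃ ω = (b₁, b₂, !b₃)).card := by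
  refine Finset.card_bij (fun ω _ => flipC f₃ ω) ?_ ?_ ?_
  · intro ω hω
    simp only [Finset.mem_filter, Finset.mem_univ, true_and, bits, Prod.mk.injEq] at hω ⊢
    obtain ⟨hb1, hb2, hb3⟩ := hω
    refine ⟨?_, ?_, ?_⟩
    · unfold flipC; rw [Function.update_of_ne h13]; exact hb1
    · unfold flipC; rw [Function.update_of_ne h23]; exact hb2
    · rw [flipC_apply_self, hb3]
  · intro ω _ ω' _ h
    exact flipC_involutive f₃ |>.injective h
  · intro ω' hω'
    refine ⟨flipC f₃ ω', ?_, flipC_involutive f₃ ω'⟩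
    simp only [Finset.mem_filter, Finset.mem_univ, true_and, bits, Prod.mk.injEq] at hω' ⊢
    obtain ⟨hb1, hb2, hb3⟩ := hω'
    refine ⟨?_, ?_, ?_⟩
    · unfold flipC; rw [Function.update_of_ne h13]; exact hb1
    · unfold flipC; rw [Function.update_of_ne h23]; exact hb2
    · rw [flipC_apply_self, hb3, Bool.not_not]

open Classical in
/-- Every fibre has the cardinality of the all-red fibre. -/
theorem card_fiber_eq {f₁ f₂ f₃ : E₁} (h12 : f₁ ≠ f₂) (h13 : f₁ ≠ f₃) (h23 : f₂ ≠ f₃) (b : Bool × Bool × Bool) :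
    (univ.filter fun ω : E₁ → Bool => bits f₁ f₂ f₃ ω = b).card =
      (univ.filter fun ω : E₁ → Bool => bits f₁ f₂ f₃ ω = (true, true, true)).card := by
  obtain ⟨b₁, b₂, b₃⟩ := b
  cases b₁ <;> cases b₂ <;> cases b₃
  · exact (card_fiber_flip₁ h12 h13 _ _ _).trans
      ((card_fiber_flip₂ h12 h23 _ _ _).trans (card_fiber_flip₃ h13 h23 _ _ _))
  · exact (card_fiber_flip₁ h12 h13 _ _ _).trans (card_fiber_flip₂ h12 h23 _ _ _)
  · exact (card_fiber_flip₁ h12 h13 _ _ _).trans (card_fiber_flip₃ h13 h23 _ _ _)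
  · exact card_fiber_flip₁ h12 h13 _ _ _
  · exact (card_fiber_flip₂ h12 h23 _ _ _).trans (card_fiber_flip₃ h13 h23 _ _ _)
  · exact card_fiber_flip₂ h12 h23 _ _ _
  · exact card_fiber_flip₃ h13 h23 _ _ _
  · rfl

open Classical in
/-- Eight times the all-red fibre is the number of colourings. -/
theorem eight_mul_card_fiber {f₁ f₂ f₃ : E₁} (h12 : f₁ ≠ f₂) (h13 : f₁ ≠ f₃) (h23 : f₂ ≠ f₃) :
    8 * (univ.filter fun ω : E₁ → Bool => bits f₁ f₂ f₃ ω = (true, true, true)).card =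
      2 ^ Fintype.card E₁ := by
  have h := Finset.card_eq_sum_card_fiberwise (s := (univ : Finset (E₁ → Bool)))
    (t := (univ : Finset (Bool × Bool × Bool))) (f := bits f₁ f₂ f₃) (fun _ _ => Finset.mem_univ _)
  rw [Finset.card_univ, Fintype.card_fun, Fintype.card_bool] at h
  rw [h]
  rw [Finset.sum_congr rfl fun b _ => card_fiber_eq h12 h13 h23 b, Finset.sum_const, Finset.card_univ]
  simp [Fintype.card_prod, Fintype.card_bool]

open Classical in
/-- **THE TRIANGLE STATUS HAS `esym ≥ 2 · 2^(#E₁ − 3)`** — the all-red and the all-blue fibres contribute `1` each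
and no colouring contributes negatively. -/
theorem esym_triSt_ge {f₁ f₂ f₃ : E₁} (hau : a₁ ≠ u) (hau' : a₁ ≠ u') (huu' : u ≠ u') (h1 : Z₁.Joins f₁ a₁ u)
    (h2 : Z₁.Joins f₂ a₁ u') (h3 : Z₁.Joins f₃ u u') (h12 : f₁ ≠ f₂) (h13 : f₁ ≠ f₃) (h23 : f₂ ≠ f₃) :
    2 * ((univ.filter fun ω : E₁ → Bool => bits f₁ f₂ f₃ ω = (true, true, true)).card : ℤ) ≤
      esym Z₁ u u' a₁ (triSt f₁ f₂ f₃) := by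
  unfold esym
  have hG : ∀ ω : E₁ → Bool, Fsym (rsig Z₁ u u' a₁ (triSt f₁ f₂ f₃) ω) (bsig Z₁ u u' a₁ (triSt f₁ f₂ f₃) ω) =
      triG (bits f₁ f₂ f₃ ω) := fun ω => by
    rw [rsig_tri Z₁ u u' a₁ hau hau' huu' h1 h2 h3, bsig_tri Z₁ u u' a₁ hau hau' huu' h1 h2 h3]; rfl
  simp only [hG]
  have hlow : ∀ ω : E₁ → Bool,
      ((if bits f₁ f₂ f₃ ω = (true, true, true) then 1 else 0) + (if bits f₁ f₂ f₃ ω = (false, false, false) then 1 else 0) : ℤ)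
        ≤ triG (bits f₁ f₂ f₃ ω) := by
    intro ω
    by_cases ht : bits f₁ f₂ f₃ ω = (true, true, true)
    · rw [ht]; simp [triG_ttt]
    · by_cases hf : bits f₁ f₂ f₃ ω = (false, false, false)
      · rw [hf]; simp [triG_fff]
      · rw [if_neg ht, if_neg hf]; simpa using triG_nonneg _
  refine le_trans ?_ (Finset.sum_le_sum fun ω _ => hlow ω)
  rw [Finset.sum_add_distrib, Finset.sum_boole, Finset.sum_boole,
    card_fiber_eq h12 h13 h23 (false, false, false)]
  linarith

/-! ## Deleting the other edges -/

/-- The status with the edges of `X` made absent. -/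
def setAbsent (st : E₁ → EStat) (X : Finset E₁) : E₁ → EStat := fun e => if e ∈ X then .absent else st e

/-- Deleting the edges of `X` one at a time multiplies the normalised excess by at most `2^#X`. -/
theorem esym_setAbsent_le (st : E₁ → EStat) (X : Finset E₁) (hX : ∀ e ∈ X, st e = .free) :
    esym Z₁ u u' a₁ (setAbsent st X) ≤ 2 ^ X.card * esym Z₁ u u' a₁ st := by
  induction X using Finset.induction_on with
  | empty =>
    have : setAbsent st ∅ = st := by funext e; simp [setAbsent]
    rw [this]; simp
  | @insert f X hf ih =>
    have hup : setAbsent st (insert f X) = Function.update (setAbsent st X) f .absent := by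
      funext e
      by_cases he : e = f
      · subst he; simp [setAbsent]
      · simp [setAbsent, he]
    have hfree : setAbsent st X f = .free := by
      simp [setAbsent, hf, hX f (Finset.mem_insert_self f X)]
    have h1 := esym_absent_le Z₁ u u' a₁ (setAbsent st X) f hfree
    have h2 := ih fun e he => hX e (Finset.mem_insert_of_mem he)
    rw [hup, Finset.card_insert_of_notMem hf, pow_succ]
    have h0 := esym_nonneg Z₁ u u' a₁ st
    nlinarith

/-- The triangle status is the all-free status with the other edges deleted. -/
theorem triSt_eq_setAbsent (f₁ f₂ f₃ : E₁) :
    triSt f₁ f₂ f₃ = setAbsent (fun _ => EStat.free) (univ.filter fun e => ¬ (e = f₁ ∨ e = f₂ ∨ e = f₃)) := by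
  funext e
  unfold triSt setAbsent
  simp only [Finset.mem_filter, Finset.mem_univ, true_and]
  by_cases h : e = f₁ ∨ e = f₂ ∨ e = f₃
  · rw [if_pos h, if_neg (not_not.mpr h)]
  · rw [if_neg h, if_pos h]

/-- The number of non-triangle edges. -/
theorem card_others {f₁ f₂ f₃ : E₁} (h12 : f₁ ≠ f₂) (h13 : f₁ ≠ f₃) (h23 : f₂ ≠ f₃) :
    (univ.filter fun e : E₁ => ¬ (e = f₁ ∨ e = f₂ ∨ e = f₃)).card + 3 = Fintype.card E₁ := by
  have h : (univ.filter fun e : E₁ => ¬ (e = f₁ ∨ e = f₂ ∨ e = f₃)) = univ \ {f₁, f₂, f₃} := by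
    ext e; simp [not_or]
  rw [h, Finset.card_univ_sdiff]
  have h3 : ({f₁, f₂, f₃} : Finset E₁).card = 3 := by
    rw [Finset.card_insert_of_notMem, Finset.card_pair h23]
    simp [h12, h13]
  rw [h3]
  have : 3 ≤ Fintype.card E₁ := by
    rw [← h3]; exact Finset.card_le_univ _
  omega

open Classical in
/-- **THEOREM (A TRIANGLE ON THE MARKS FORCES `e ≥ 1`)**, integer form: `esym (all free) ≥ 2`. -/
theorem esym_free_ge_two_of_triangle {f₁ f₂ f₃ : E₁} (hau : a₁ ≠ u) (hau' : a₁ ≠ u') (huu' : u ≠ u')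
    (h1 : Z₁.Joins f₁ a₁ u) (h2 : Z₁.Joins f₂ a₁ u') (h3 : Z₁.Joins f₃ u u') :
    2 ≤ esym Z₁ u u' a₁ (fun _ => EStat.free) := by
  have h12 : f₁ ≠ f₂ := by
    rintro rfl
    rcases joins_unique h1 h2 with ⟨_, h⟩ | ⟨h, _⟩
    · exact huu' h.symm
    · exact hau h
  have h13 : f₁ ≠ f₃ := by
    rintro rfl
    rcases joins_unique h1 h3 with ⟨h, _⟩ | ⟨_, h⟩
    · exact hau h.symm
    · exact hau' h.symm
  have h23 : f₂ ≠ f₃ := by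
    rintro rfl
    rcases joins_unique h2 h3 with ⟨h, _⟩ | ⟨_, h⟩
    · exact hau h.symm
    · exact hau' h.symm
  have hfib := esym_triSt_ge Z₁ u u' a₁ hau hau' huu' h1 h2 h3 h12 h13 h23
  have hcard := eight_mul_card_fiber (E₁ := E₁) h12 h13 h23
  have hdel := esym_setAbsent_le Z₁ u u' a₁ (fun _ => EStat.free)
    (univ.filter fun e => ¬ (e = f₁ ∨ e = f₂ ∨ e = f₃)) (fun _ _ => rfl)
  rw [← triSt_eq_setAbsent] at hdel
  have hk := card_others (E₁ := E₁) h12 h13 h23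
  have hpow : (2 : ℕ) ^ Fintype.card E₁ =
      2 ^ (univ.filter fun e : E₁ => ¬ (e = f₁ ∨ e = f₂ ∨ e = f₃)).card * 8 := by
    rw [← hk, pow_add]; norm_num
  have hN8 : ((univ.filter fun ω : E₁ → Bool => bits f₁ f₂ f₃ ω = (true, true, true)).card : ℤ) =
      2 ^ (univ.filter fun e : E₁ => ¬ (e = f₁ ∨ e = f₂ ∨ e = f₃)).card := by
    have h8 := hcard.trans hpow
    have : (8 * (univ.filter fun ω : E₁ → Bool => bits f₁ f₂ f₃ ω = (true, true, true)).card : ℤ) =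
        2 ^ (univ.filter fun e : E₁ => ¬ (e = f₁ ∨ e = f₂ ∨ e = f₃)).card * 8 := by exact_mod_cast h8
    linarith
  have hpos : (0 : ℤ) < 2 ^ (univ.filter fun e : E₁ => ¬ (e = f₁ ∨ e = f₂ ∨ e = f₃)).card := by positivity
  have h2 : (2 : ℤ) ^ (univ.filter fun e : E₁ => ¬ (e = f₁ ∨ e = f₂ ∨ e = f₃)).card * 2 ≤
      2 ^ (univ.filter fun e : E₁ => ¬ (e = f₁ ∨ e = f₂ ∨ e = f₃)).card * esym Z₁ u u' a₁ (fun _ => EStat.free) := by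
    have := hfib.trans hdel
    rw [hN8] at this
    linarith
  exact le_of_mul_le_mul_left h2 hpos

open Classical in
/-- **THEOREM (A TRIANGLE ON THE MARKS FORCES `e ≥ 1`)**: if the three distinct marks are pairwise joined by edges,
`N_RRa ≥ N_RB + N_WRj + N_RWj + 1`. -/
theorem excess_ge_one_of_triangle {f₁ f₂ f₃ : E₁} (hau : a₁ ≠ u) (hau' : a₁ ≠ u') (huu' : u ≠ u')
    (h1 : Z₁.Joins f₁ a₁ u) (h2 : Z₁.Joins f₂ a₁ u') (h3 : Z₁.Joins f₃ u u') : 1 ≤ excess Z₁ u u' a₁ := by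
  rw [excess_eq_excessZ Z₁ u u' a₁]
  have h := esym_free_ge_two_of_triangle Z₁ u u' a₁ hau hau' huu' h1 h2 h3
  rw [esym_free_eq Z₁ u u' a₁] at h
  have : (1 : ℤ) ≤ excessZ Z₁ u u' a₁ := by omega
  exact_mod_cast this

end MultiExit

end ZoneZ

end PercRepro
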